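import Summits.ABC.ABC.Theorems.TowerFourSubLiouville.Negative.HallLangTransfer

/-!
# `TowerFourSubLiouville` (stmt-ABC-1649): the transfer dials are PINNED at their `ABC` thresholds —
# `UniformLjunggren K` fails for every `K < 1`, `HallLang1728 κ` for every `κ < 2` (a Pell-boosted family)

Negative-side calibration (standing disprover, cycle 9, refuter-cdisprove-stmt-ABC-1649-g9-0, 2026-08-16) of the CORE
stub of the picked line `SketchIdeator5` (card `cm-hall-lang-transfer`, lead a1; `Cruxes/TowerFourSubLiouville/Lines/
SketchIdeator5.lean`, `PICKED.md`): `stub_hallLang1728 = HallLang1728 := ∃ κ C, 0 < C ∧ ∀ N x y : ℤ, N ≠ 0 →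
y² = x³ + N x → |x| ≤ C |N|^κ`, equivalently (stubs 2 + certificate) `UniformLjunggren := ∃ K C, … x² − d y⁴ = k,
d ≠ □, k ≠ 0 ⟹ |y| ≤ C (|d||k|)^K`.  Cycle 8 (`Negative.HallLangTransfer`, p131589) proved the floors `κ ≥ 3/2`,
`K ≥ 1/2` by the Mason–Stothers-extremal polynomial identity of degree `μ = 2`, and recorded that higher extremal
identities are irrational, leaving the windows `K ∈ [1/2, 1]`, `κ ∈ [3/2, 2]` open ("a Pell-boosted family would settle
`κ < 2` at once … none found", Disproof.lean § (8e)(v)).  This file closes both windows with such a family: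

  **`u² = 2t² + 1 ⟹ (4u(t+1))² − 2·(2t+1)⁴ = 16t + 14`**   (`pellBoost_identity`),

i.e. along the Pell sequence `(u, t) = (3,2), (17,12), (99,70), …` the equation `x² − 2y⁴ = k` has the solutions
`y = 2t + 1`, `k = 16t + 14` with `|d|·|k| = 32t + 28 = 16y + 12` — the exponent is `K = 1` on the nose
(`‖(2t+1)²√2‖ ≈ 2√2/(2t+1)`: in `(2t+1)²√2 = 4t²√2 + 4t√2 + √2` the constant terms `∓√2` of `4t²√2 ≈ 4tu − √2` and
`4t√2 + √2 ≈ 4u + √2` cancel).  In Hall–Lang coordinates (`x = d y'²`, `N = d k`): the integral points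
`(x, y) = (2(2t+1)², 8u(t+1)(2t+1))` on `y² = x³ + (32t + 28)·x` (`pellBoost_onCurve`) have `x = N²/128 + O(N)`.
Origin of the identity (seat notes): on the conic `u² − 2t² = 1` the coordinate ring is `ℚ(√2)[w, 1/w]`,
`w = u + t√2`; Laurent solutions `n² − 2m⁴ = k` with `m = a w + b + σ(a) w⁻¹` exist iff `N(a) = −b²/2`, and then
`k = 2b³(4m + 3b)`; here `(a, b) = (√2/2, 1)`.  Mason–Stothers on the conic gives `deg k ≥ deg m` for every such
Laurent family, i.e. NO family of this kind goes beyond `K = 1` / `κ = 2` — which are exactly the `ABC` exponents.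

Consequences (sorry-free; matrices VERBATIM those of the registered stub `stub_hallLang1728` / of
`SketchIdeator5.UniformLjunggren`, and of ideator 4's variant with `y ≠ 0`, `Cruxes/…/SketchIdeator4.lean`):
* `not_uniformLjunggren_of_lt_one`: `UniformLjunggren K` is FALSE for every `K < 1` (supersedes `K < 1/2`);
* `not_uniformLjunggren_one_of_lt_sixteenth`: at `K = 1` the constant must be `C ≥ 1/16`;
* `not_hallLang1728_of_lt_two` (and `not_hallLang1728_ne_zero_of_lt_two`, the `y ≠ 0` matrix): `HallLang1728 κ` is
  FALSE for every `κ < 2` (supersedes `κ < 3/2`);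
* `not_hallLang1728_two_of_lt`: at `κ = 2` the constant must be `C ≥ 1/128`.

THE DIALS ARE NOW PINNED (for the lead / planners).  Upper side (Disproof.lean § (8c), informal there): `ABC ⟹
UniformLjunggren K` for every `K > 1` (`|y| ≪_ε d^{1/2+ε}|k|^{1+ε}`) and `ABC ⟹ HallLang1728 κ` for every `κ > 2`;
the random model puts the thresholds at `K = 1`, `κ = 2` with log-divergence AT the threshold (so conjecturally
`K = 1` / `κ = 2` fail for every `C`; this file gives `C < 1/16` / `C < 1/128`).  Hence: the core stub of the line has NO
sub-threshold regime left — any proof of `stub_hallLang1728` must produce `κ ≥ 2`, the full conjectural Hall–Lang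
exponent of the `j = 1728` family (Lang's conjecture `h(P) ≪ log |Δ|` with the optimal constant for this family), and
the transfer then hands the crux only `η < 1/(4K+2) ≤ 1/6` (card's rate; `1/17` at the landed stub's rate
`η = 1/(1 + 16K)`).  The family is OFF the crux fibre `(d, k, x) = (vw, aw, wZ²)` (there `ABC` pins the dial at `1/2`,
`Negative.HallLangTransferCruxFibre`, p131711): `4u(t+1) = wZ²` with `w ∣ 2` holds only sporadically.
No statement here is a Theses decl; nothing positive about the crux is asserted.
-/

-- `Summit.ABC.ABC` is the mandated summit-side namespace (CONVENTIONS §2); the duplicate is deliberate.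
set_option linter.dupNamespace false

namespace Summit.ABC.ABC.Theorems.TowerFourSubLiouville.Negative

/-! ## The Pell-boosted identity and its Hall–Lang form -/

/-- **Pell-boosted Ljunggren family**: on `u² = 2t² + 1`, `(4u(t+1))² − 2(2t+1)⁴ = 16t + 14`. -/
theorem pellBoost_identity {u t : ℤ} (h : u ^ 2 = 2 * t ^ 2 + 1) :
    (4 * u * (t + 1)) ^ 2 - 2 * (2 * t + 1) ^ 4 = 16 * t + 14 := by
  linear_combination (16 * (t + 1) ^ 2) * h

/-- The same family as integral points on `y² = x³ + N x`: `x = 2(2t+1)²`, `N = 32t + 28`, `y = 8u(t+1)(2t+1)`. -/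
theorem pellBoost_onCurve {u t : ℤ} (h : u ^ 2 = 2 * t ^ 2 + 1) :
    (8 * u * (t + 1) * (2 * t + 1)) ^ 2 =
      (2 * (2 * t + 1) ^ 2) ^ 3 + (32 * t + 28) * (2 * (2 * t + 1) ^ 2) := by
  linear_combination (64 * (t + 1) ^ 2 * (2 * t + 1) ^ 2) * h

/-- Worked members `t = 2, 12, 70`: `36² − 2·5⁴ = 46`, `884² − 2·25⁴ = 206`, `28116² − 2·141⁴ = 1134`. -/
example : (36 : ℤ) ^ 2 - 2 * 5 ^ 4 = 46 ∧ (884 : ℤ) ^ 2 - 2 * 25 ^ 4 = 206 ∧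
    (28116 : ℤ) ^ 2 - 2 * 141 ^ 4 = 1134 := by norm_num

/-! ## The Pell sequence `u² − 2t² = 1` is unbounded -/

/-- One step of the Pell recursion `(u, t) ↦ (3u + 4t, 2u + 3t)`. -/
theorem pellBoost_step {u t : ℤ} (h : u ^ 2 = 2 * t ^ 2 + 1) :
    (3 * u + 4 * t) ^ 2 = 2 * (2 * u + 3 * t) ^ 2 + 1 := by
  linear_combination h

/-- Arbitrarily large solutions of `u² = 2t² + 1` with `u ≥ 1`, `t ≥ n + 2`. -/
theorem pellBoost_exists (n : ℕ) : ∃ u t : ℤ, u ^ 2 = 2 * t ^ 2 + 1 ∧ 1 ≤ u ∧ (n : ℤ) + 2 ≤ t := by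
  induction n with
  | zero => exact ⟨3, 2, by norm_num, by norm_num, by norm_num⟩
  | succ n ih =>
    obtain ⟨u, t, h, hu, ht⟩ := ih
    refine ⟨3 * u + 4 * t, 2 * u + 3 * t, pellBoost_step h, ?_, ?_⟩
    · have : (0 : ℤ) ≤ t := by omega
      nlinarith
    · push_cast
      omega

/-- A Pell solution `u² = 2t² + 1` with `t ≥ 1` beyond any real threshold. -/
theorem pellBoost_exists_ge (M : ℝ) : ∃ u t : ℤ, u ^ 2 = 2 * t ^ 2 + 1 ∧ 1 ≤ u ∧ 1 ≤ t ∧ M ≤ (t : ℝ) := by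
  obtain ⟨n, hn⟩ := exists_nat_ge M
  obtain ⟨u, t, h, hu, ht⟩ := pellBoost_exists n
  refine ⟨u, t, h, hu, by omega, le_trans hn ?_⟩
  have : ((n : ℤ) : ℝ) ≤ (t : ℝ) := by exact_mod_cast (by omega : (n : ℤ) ≤ t)
  simpa using this

/-! ## Size bookkeeping (for `t ≥ 1`) -/

/-- `2` is not a square in `ℤ` (squares are `0, 1 (mod 3)`). -/
theorem pellBoost_two_not_isSquare : ¬ IsSquare (2 : ℤ) := by
  rintro ⟨r, hr⟩
  have h3 : ∀ s : ZMod 3, (2 : ZMod 3) ≠ s * s := by decide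
  have := congrArg (Int.cast : ℤ → ZMod 3) hr
  push_cast at this
  exact h3 _ this

/-- `k = 16t + 14 ≠ 0`. -/
theorem pellBoost_k_ne_zero {t : ℤ} (ht : 1 ≤ t) : (16 * t + 14 : ℤ) ≠ 0 := by omega

/-- `|d|·|k| = 32t + 28 ≤ 60t`. -/
theorem pellBoost_dk_abs {t : ℤ} (ht : 1 ≤ t) : |(2 : ℤ)| * |16 * t + 14| ≤ 60 * t := by
  rw [abs_of_pos (by norm_num : (0 : ℤ) < 2), abs_of_pos (by omega : (0 : ℤ) < 16 * t + 14)]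
  omega

/-- `|d|·|k| = 32t + 28` exactly. -/
theorem pellBoost_dk_eq {t : ℤ} (ht : 1 ≤ t) : |(2 : ℤ)| * |16 * t + 14| = 32 * t + 28 := by
  rw [abs_of_pos (by norm_num : (0 : ℤ) < 2), abs_of_pos (by omega : (0 : ℤ) < 16 * t + 14)]
  ring

/-- `|d|·|k| ≥ 1`. -/
theorem pellBoost_dk_one_le {t : ℤ} (ht : 1 ≤ t) : 1 ≤ |(2 : ℤ)| * |16 * t + 14| := by
  rw [pellBoost_dk_eq ht]; omega

/-- `N = 32t + 28 ≠ 0`. -/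
theorem pellBoost_N_ne_zero {t : ℤ} (ht : 1 ≤ t) : (32 * t + 28 : ℤ) ≠ 0 := by omega

/-- `|N| ≤ 60t`. -/
theorem pellBoost_N_abs {t : ℤ} (ht : 1 ≤ t) : |(32 * t + 28 : ℤ)| ≤ 60 * t := by
  rw [abs_of_pos (by omega : (0 : ℤ) < 32 * t + 28)]; omega

/-- `x = 2(2t+1)² ≥ t²`, indeed `= 8t² + 8t + 2`. -/
theorem pellBoost_x_eq (t : ℤ) : 2 * (2 * t + 1) ^ 2 = 8 * t ^ 2 + 8 * t + 2 := by ring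

/-- `x ≥ t²` for `t ≥ 1`. -/
theorem pellBoost_x_lower {t : ℤ} (ht : 1 ≤ t) : t ^ 2 ≤ 2 * (2 * t + 1) ^ 2 := by nlinarith

/-- `x > 0` for `t ≥ 1`. -/
theorem pellBoost_x_pos {t : ℤ} (ht : 1 ≤ t) : 0 < 2 * (2 * t + 1) ^ 2 := by nlinarith

/-- `y = 8u(t+1)(2t+1) ≠ 0` on the family. -/
theorem pellBoost_y_ne_zero {u t : ℤ} (hu : 1 ≤ u) (ht : 1 ≤ t) : 8 * u * (t + 1) * (2 * t + 1) ≠ 0 := by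
  have h1 : (0 : ℤ) < 8 * u := by omega
  have h2 : (0 : ℤ) < t + 1 := by omega
  have h3 : (0 : ℤ) < 2 * t + 1 := by omega
  exact (mul_pos (mul_pos h1 h2) h3).ne'

/-- Real-exponent bookkeeping: `t^κ = (t²)^{κ/2}` for `t ≥ 0`. -/
theorem rpow_eq_sq_rpow_half {t : ℝ} (ht : 0 ≤ t) (κ : ℝ) : t ^ κ = (t ^ 2) ^ (κ / 2) := by
  rw [← Real.rpow_natCast t 2, ← Real.rpow_mul ht]
  congr 1
  push_cast
  ring

/-! ## `UniformLjunggren K` fails for every `K < 1`, and at `K = 1` needs `C ≥ 1/16` -/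

/-- The family beats `C·(|d||k|)^K` for every `K < 1` and every `C`. -/
theorem pellBoost_beats_UL (K : ℝ) (hK : K < 1) (C : ℝ) :
    ∃ d k x y : ℤ, ¬ IsSquare d ∧ k ≠ 0 ∧ x ^ 2 - d * y ^ 4 = k ∧
      C * ((|d| * |k| : ℤ) : ℝ) ^ K < (|y| : ℝ) := by
  set K' : ℝ := max K 0 with hK'def
  have hK'0 : 0 ≤ K' := le_max_right _ _
  have hK'lt : K' < 1 := max_lt hK (by norm_num)
  set C' : ℝ := max C 1 with hC'def
  have hC'0 : 0 < C' := lt_of_lt_of_le zero_lt_one (le_max_right _ _)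
  obtain ⟨M, -, hM⟩ := key_growth (K := 2 * C' * (60 : ℝ) ^ K') (by positivity) hK'lt
  obtain ⟨u, t, hpell, hu, ht1, htM⟩ := pellBoost_exists_ge M
  have ht1R : (1 : ℝ) ≤ (t : ℝ) := by exact_mod_cast ht1
  have ht0R : (0 : ℝ) ≤ (t : ℝ) := by linarith
  refine ⟨2, 16 * t + 14, 4 * u * (t + 1), 2 * t + 1, pellBoost_two_not_isSquare, pellBoost_k_ne_zero ht1,
    pellBoost_identity hpell, ?_⟩
  -- sizes, cast to ℝ
  have hR1 : (((|(2 : ℤ)| * |16 * t + 14|) : ℤ) : ℝ) ≤ 60 * (t : ℝ) := by exact_mod_cast pellBoost_dk_abs ht1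
  have hRone : (1 : ℝ) ≤ (((|(2 : ℤ)| * |16 * t + 14|) : ℤ) : ℝ) := by exact_mod_cast pellBoost_dk_one_le ht1
  have hR0 : (0 : ℝ) ≤ (((|(2 : ℤ)| * |16 * t + 14|) : ℤ) : ℝ) := le_trans zero_le_one hRone
  have hY : (t : ℝ) < |((2 * t + 1 : ℤ) : ℝ)| := by
    rw [← Int.cast_abs, abs_of_pos (by omega : (0 : ℤ) < 2 * t + 1)]; push_cast; linarith
  have h4 := hM (t : ℝ) htM
  have h3 : ((60 : ℝ) * (t : ℝ)) ^ K' = (60 : ℝ) ^ K' * (t : ℝ) ^ K' := Real.mul_rpow (by norm_num) ht0R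
  have ht0 : (0 : ℝ) < (t : ℝ) := by linarith
  have hpowK : (0 : ℝ) ≤ (((|(2 : ℤ)| * |16 * t + 14|) : ℤ) : ℝ) ^ K := Real.rpow_nonneg hR0 _
  calc C * (((|(2 : ℤ)| * |16 * t + 14|) : ℤ) : ℝ) ^ K
      ≤ C' * (((|(2 : ℤ)| * |16 * t + 14|) : ℤ) : ℝ) ^ K := mul_le_mul_of_nonneg_right (le_max_left _ _) hpowK
    _ ≤ C' * (((|(2 : ℤ)| * |16 * t + 14|) : ℤ) : ℝ) ^ K' :=
        mul_le_mul_of_nonneg_left (Real.rpow_le_rpow_of_exponent_le hRone (le_max_left _ _)) hC'0.le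
    _ ≤ C' * ((60 : ℝ) * (t : ℝ)) ^ K' := mul_le_mul_of_nonneg_left (Real.rpow_le_rpow hR0 hR1 hK'0) hC'0.le
    _ = (2 * C' * (60 : ℝ) ^ K' * (t : ℝ) ^ K') / 2 := by rw [h3]; ring
    _ ≤ (t : ℝ) / 2 := by linarith
    _ < (t : ℝ) := by linarith
    _ < |((2 * t + 1 : ℤ) : ℝ)| := hY

/-- **Uniform Ljunggren needs `K ≥ 1`.**  The matrix is `SketchIdeator5.UniformLjunggren K` verbatim
(supersedes `not_uniformLjunggren_of_lt_half`). -/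
theorem not_uniformLjunggren_of_lt_one (K : ℝ) (hK : K < 1) :
    ¬ ∃ C : ℝ, 0 < C ∧ ∀ d k x y : ℤ, ¬ IsSquare d → k ≠ 0 → x ^ 2 - d * y ^ 4 = k →
      (|y| : ℝ) ≤ C * ((|d| * |k| : ℤ) : ℝ) ^ K := by
  rintro ⟨C, -, h⟩
  obtain ⟨d, k, x, y, hd, hk, he, hlt⟩ := pellBoost_beats_UL K hK C
  exact (not_le.mpr hlt) (h d k x y hd hk he)

/-- … hence the existential `UniformLjunggren := ∃ K C, …` (the card's `C⁺`) can only hold with `K ≥ 1`. -/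
theorem uniformLjunggren_exponent_ge_one (K C : ℝ)
    (h : ∀ d k x y : ℤ, ¬ IsSquare d → k ≠ 0 → x ^ 2 - d * y ^ 4 = k →
      (|y| : ℝ) ≤ C * ((|d| * |k| : ℤ) : ℝ) ^ K) : 1 ≤ K := by
  by_contra hK
  obtain ⟨d, k, x, y, hd, hk, he, hlt⟩ := pellBoost_beats_UL K (not_le.mp hK) C
  exact (not_le.mpr hlt) (h d k x y hd hk he)

/-- **At the threshold `K = 1` the constant must be `≥ 1/16`** (`|y| = 2t+1` against `|d||k| = 32t + 28 = 16|y| + 12`). -/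
theorem not_uniformLjunggren_one_of_lt_sixteenth (C : ℝ) (hC : C < 1 / 16) :
    ¬ ∀ d k x y : ℤ, ¬ IsSquare d → k ≠ 0 → x ^ 2 - d * y ^ 4 = k →
      (|y| : ℝ) ≤ C * ((|d| * |k| : ℤ) : ℝ) ^ (1 : ℝ) := by
  intro h
  have hδ : (0 : ℝ) < 2 - 32 * C := by linarith
  obtain ⟨u, t, hpell, -, ht1, htM⟩ := pellBoost_exists_ge (2 / (2 - 32 * C))
  have key := h 2 (16 * t + 14) (4 * u * (t + 1)) (2 * t + 1) pellBoost_two_not_isSquare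
    (pellBoost_k_ne_zero ht1) (pellBoost_identity hpell)
  rw [Real.rpow_one] at key
  have hR : (((|(2 : ℤ)| * |16 * t + 14|) : ℤ) : ℝ) = 32 * (t : ℝ) + 28 := by
    exact_mod_cast pellBoost_dk_eq ht1
  have hY : |((2 * t + 1 : ℤ) : ℝ)| = 2 * (t : ℝ) + 1 := by
    rw [← Int.cast_abs, abs_of_pos (by omega : (0 : ℤ) < 2 * t + 1)]; push_cast; ring
  rw [hR, hY] at key
  have h2 : 2 ≤ (t : ℝ) * (2 - 32 * C) := (div_le_iff₀ hδ).mp htM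
  nlinarith

/-! ## `HallLang1728 κ` fails for every `κ < 2`, and at `κ = 2` needs `C ≥ 1/128` -/

/-- The family beats `C·|N|^κ` for every `κ < 2` and every `C`, with `y ≠ 0` and `x > 0`. -/
theorem pellBoost_beats_HL (κ : ℝ) (hκ : κ < 2) (C : ℝ) :
    ∃ N x y : ℤ, N ≠ 0 ∧ y ≠ 0 ∧ 0 < x ∧ y ^ 2 = x ^ 3 + N * x ∧ C * (|N| : ℝ) ^ κ < (|x| : ℝ) := by
  set κ' : ℝ := max κ 0 with hκ'def
  have hκ'0 : 0 ≤ κ' := le_max_right _ _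
  have hκ'lt : κ' < 2 := max_lt hκ (by norm_num)
  have hs : κ' / 2 < 1 := by linarith
  set C' : ℝ := max C 1 with hC'def
  have hC'0 : 0 < C' := lt_of_lt_of_le zero_lt_one (le_max_right _ _)
  obtain ⟨M, hM1, hM⟩ := key_growth (K := 2 * C' * (60 : ℝ) ^ κ') (by positivity) hs
  obtain ⟨u, t, hpell, hu, ht1, htM⟩ := pellBoost_exists_ge M
  have ht1R : (1 : ℝ) ≤ (t : ℝ) := by exact_mod_cast ht1
  have ht0R : (0 : ℝ) ≤ (t : ℝ) := by linarith
  refine ⟨32 * t + 28, 2 * (2 * t + 1) ^ 2, 8 * u * (t + 1) * (2 * t + 1), pellBoost_N_ne_zero ht1,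
    pellBoost_y_ne_zero hu ht1, pellBoost_x_pos ht1, pellBoost_onCurve hpell, ?_⟩
  -- sizes, cast to ℝ
  have hN1 : |((32 * t + 28 : ℤ) : ℝ)| ≤ 60 * (t : ℝ) := by
    rw [← Int.cast_abs]; exact_mod_cast pellBoost_N_abs ht1
  have hNone : (1 : ℝ) ≤ |((32 * t + 28 : ℤ) : ℝ)| := by
    rw [← Int.cast_abs]; exact_mod_cast Int.one_le_abs (pellBoost_N_ne_zero ht1)
  have hX1 : (t : ℝ) ^ 2 ≤ ((2 * (2 * t + 1) ^ 2 : ℤ) : ℝ) := by exact_mod_cast pellBoost_x_lower ht1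
  have hXabs : |((2 * (2 * t + 1) ^ 2 : ℤ) : ℝ)| = ((2 * (2 * t + 1) ^ 2 : ℤ) : ℝ) :=
    abs_of_pos (by exact_mod_cast pellBoost_x_pos ht1)
  -- growth at `T = t²`
  have hT : M ≤ (t : ℝ) ^ 2 := le_trans htM (by nlinarith)
  have h4 := hM ((t : ℝ) ^ 2) hT
  have h3 : ((60 : ℝ) * (t : ℝ)) ^ κ' = (60 : ℝ) ^ κ' * ((t : ℝ) ^ 2) ^ (κ' / 2) := by
    rw [Real.mul_rpow (by norm_num) ht0R, rpow_eq_sq_rpow_half ht0R]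
  have ht2 : (0 : ℝ) < (t : ℝ) ^ 2 := by positivity
  have hpowκ : (0 : ℝ) ≤ |((32 * t + 28 : ℤ) : ℝ)| ^ κ := Real.rpow_nonneg (abs_nonneg _) _
  calc C * |((32 * t + 28 : ℤ) : ℝ)| ^ κ
      ≤ C' * |((32 * t + 28 : ℤ) : ℝ)| ^ κ := mul_le_mul_of_nonneg_right (le_max_left _ _) hpowκ
    _ ≤ C' * |((32 * t + 28 : ℤ) : ℝ)| ^ κ' :=
        mul_le_mul_of_nonneg_left (Real.rpow_le_rpow_of_exponent_le hNone (le_max_left _ _)) hC'0.le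
    _ ≤ C' * ((60 : ℝ) * (t : ℝ)) ^ κ' :=
        mul_le_mul_of_nonneg_left (Real.rpow_le_rpow (abs_nonneg _) hN1 hκ'0) hC'0.le
    _ = (2 * C' * (60 : ℝ) ^ κ' * ((t : ℝ) ^ 2) ^ (κ' / 2)) / 2 := by rw [h3]; ring
    _ ≤ (t : ℝ) ^ 2 / 2 := by linarith
    _ < (t : ℝ) ^ 2 := by linarith
    _ ≤ ((2 * (2 * t + 1) ^ 2 : ℤ) : ℝ) := hX1
    _ = |((2 * (2 * t + 1) ^ 2 : ℤ) : ℝ)| := hXabs.symm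

/-- **Hall–Lang for the `j = 1728` family needs `κ ≥ 2`.**  The matrix is the registered stub
`stub_hallLang1728` (`SketchIdeator5.HallLang1728 κ`) verbatim (supersedes `not_hallLang1728_of_lt_three_halves`). -/
theorem not_hallLang1728_of_lt_two (κ : ℝ) (hκ : κ < 2) :
    ¬ ∃ C : ℝ, 0 < C ∧ ∀ N x y : ℤ, N ≠ 0 → y ^ 2 = x ^ 3 + N * x →
      (|x| : ℝ) ≤ C * (|N| : ℝ) ^ κ := by
  rintro ⟨C, -, h⟩
  obtain ⟨N, x, y, hN, -, -, he, hlt⟩ := pellBoost_beats_HL κ hκ C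
  exact (not_le.mpr hlt) (h N x y hN he)

/-- The same for ideator 4's matrix (`Cruxes/…/SketchIdeator4.lean: HallLang1728`), which also excludes `y = 0`. -/
theorem not_hallLang1728_ne_zero_of_lt_two (κ : ℝ) (hκ : κ < 2) :
    ¬ ∃ C : ℝ, 0 < C ∧ ∀ N x y : ℤ, N ≠ 0 → y ≠ 0 → y ^ 2 = x ^ 3 + N * x →
      (|x| : ℝ) ≤ C * (|N| : ℝ) ^ κ := by
  rintro ⟨C, -, h⟩
  obtain ⟨N, x, y, hN, hy, -, he, hlt⟩ := pellBoost_beats_HL κ hκ C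
  exact (not_le.mpr hlt) (h N x y hN hy he)

/-- … hence the existential `HallLang1728 := ∃ κ C, …` (the line's CORE stub) can only hold with `κ ≥ 2`. -/
theorem hallLang1728_exponent_ge_two (κ C : ℝ)
    (h : ∀ N x y : ℤ, N ≠ 0 → y ^ 2 = x ^ 3 + N * x → (|x| : ℝ) ≤ C * (|N| : ℝ) ^ κ) : 2 ≤ κ := by
  by_contra hκ
  obtain ⟨N, x, y, hN, -, -, he, hlt⟩ := pellBoost_beats_HL κ (not_le.mp hκ) C
  exact (not_le.mpr hlt) (h N x y hN he)

/-- **At the threshold `κ = 2` the constant must be `≥ 1/128`** (`x = 8t² + 8t + 2` against `N² = (32t + 28)²`). -/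
theorem not_hallLang1728_two_of_lt (C : ℝ) (hC : C < 1 / 128) :
    ¬ ∀ N x y : ℤ, N ≠ 0 → y ^ 2 = x ^ 3 + N * x → (|x| : ℝ) ≤ C * (|N| : ℝ) ^ (2 : ℝ) := by
  intro h
  have hδ : (0 : ℝ) < 8 - 1024 * C := by linarith
  obtain ⟨u, t, hpell, -, ht1, htM⟩ := pellBoost_exists_ge (11 / (8 - 1024 * C))
  have ht1R : (1 : ℝ) ≤ (t : ℝ) := by exact_mod_cast ht1
  have key := h (32 * t + 28) (2 * (2 * t + 1) ^ 2) (8 * u * (t + 1) * (2 * t + 1))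
    (pellBoost_N_ne_zero ht1) (pellBoost_onCurve hpell)
  rw [Real.rpow_two] at key
  have hN : |((32 * t + 28 : ℤ) : ℝ)| = 32 * (t : ℝ) + 28 := by
    rw [← Int.cast_abs, abs_of_pos (by omega : (0 : ℤ) < 32 * t + 28)]; push_cast; ring
  have hX : |((2 * (2 * t + 1) ^ 2 : ℤ) : ℝ)| = 8 * (t : ℝ) ^ 2 + 8 * (t : ℝ) + 2 := by
    rw [← Int.cast_abs, abs_of_pos (pellBoost_x_pos ht1)]; push_cast; ring
  rw [hN, hX] at key
  have h2 : 11 ≤ (t : ℝ) * (8 - 1024 * C) := (div_le_iff₀ hδ).mp htM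
  have h3 : 11 * (t : ℝ) ≤ (t : ℝ) * (8 - 1024 * C) * (t : ℝ) := by nlinarith
  have hC0 : 1024 * C < 8 := by linarith
  nlinarith [mul_nonneg (by linarith : (0 : ℝ) ≤ 8 - 1024 * C) (by linarith : (0 : ℝ) ≤ (t : ℝ))]

/-! ## Cross-checks against cycle 8 (the new floors contain the old ones) -/

example : ¬ ∃ C : ℝ, 0 < C ∧ ∀ N x y : ℤ, N ≠ 0 → y ^ 2 = x ^ 3 + N * x →
    (|x| : ℝ) ≤ C * (|N| : ℝ) ^ ((3 : ℝ) / 2) := not_hallLang1728_of_lt_two _ (by norm_num)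

example : ¬ ∃ C : ℝ, 0 < C ∧ ∀ d k x y : ℤ, ¬ IsSquare d → k ≠ 0 → x ^ 2 - d * y ^ 4 = k →
    (|y| : ℝ) ≤ C * ((|d| * |k| : ℤ) : ℝ) ^ ((1 : ℝ) / 2) := not_uniformLjunggren_of_lt_one _ (by norm_num)

end Summit.ABC.ABC.Theorems.TowerFourSubLiouville.Negative
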